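import Literature.NumberTheory.EllipticCurves.CongruentNumberMonskySelmerParityEven
import Literature.NumberTheory.EllipticCurves.HeathBrown1994.CongruentTwoSelmerMonskyFamilies
import Literature.NumberTheory.EllipticCurves.CongruentNumberOddMonskySelmerExact
import Literature.NumberTheory.EllipticCurves.CongruentNumberEvenMonskySelmerExact
import HarnessLib

/-!
# Monsky's parity theorem for `s(D)` — part 8: the bound `s(D) ≤ 2ω − k_D` and the one-prime table

Monsky's chain (appendix to Heath-Brown, Invent. Math. **118** (1994), typescript p. 40 L33–L36
[HeathBrown1994SelmerCongruentII]) ends in the identity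

> `s(D) = 2n − k − rank(M₃)`, `k = 0, 1, 2` for `D ≡ 1; 5 or 7; 3 (mod 8)`

(`n = ω(D)`, `M₃` alternating), and in the even case `s(D) = 2Ω(D₀) − δ − rank(M₂ − rᵀr)`,
`δ = [D₀ ≡ 3 (mod 4)]` (p. 41 L33–L36).  Parts 3–4 of this series record it as
`rank_monskyMatrixOdd_eq_add` / `rank_monskyMatrixEven_eq_add`.  Besides the parity of `s(D)` it
gives the BOUND `s(D) ≤ 2ω(D) − k_D` (resp. `≤ 2Ω(D₀) − δ`), sharpening the trivial `s(D) ≤ 2ω(D)`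
(Heath-Brown §1, p. 5 L14).  With the parity this pins down the one-prime values printed by
Heath-Brown (§1 p. 6 L26–L28): "When `D` is prime one sees that `s(D)` is `2` for `D ≡ 1 (mod 8)`,
is `0` for `D ≡ 3 (mod 8)`, and is `1` for `D ≡ 5` or `7 (mod 8)`"; and the analogous table for
`D = 2p` (`s = 2, 1, 0, 1` for `p ≡ 1, 3, 5, 7 (mod 8)`; evaluation of the printed matrix, ours).

## What is here (all PROVED; no definitions, no named facts)

* §1 `monskySelmerRankOdd_add_le` (`s(D) + [D ≡ 3 (4)] + [D ≡ ±3 (8)] ≤ 2ω(D)`) and its readings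
  `…_le_of_mod_eight_three` (`s ≤ 2ω − 2`), `…_le_of_mod_eight_five_or_seven` (`s ≤ 2ω − 1`);
  `monskySelmerRankEven_add_le` (`s(2D₀) + [D₀ ≡ 3 (4)] ≤ 2Ω(D₀)`).
* §2 `monskySelmerRankOdd_prime` — Heath-Brown's one-prime table, every odd prime `p`;
  `card_selmerGroup_two_congruentNumberCurve_prime` — `#Sel⁽²⁾(E_p/ℚ) = 16, 4, 8, 8` for
  `p ≡ 1, 3, 5, 7 (mod 8)` (with the tree's `monsky_card_selmerGroup_two_odd_holds`).
* §3 `monskySelmerRankEven_prime`, `card_selmerGroup_two_congruentNumberCurve_two_mul_prime` —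
  the table for `D = 2p`: `#Sel⁽²⁾(E_{2p}/ℚ) = 16, 8, 4, 8` for `p ≡ 1, 3, 5, 7 (mod 8)`.

Cell `bsd-monsky` (prover-B).  AI provenance: written by an AI assistant; no human has reviewed it.

## References

* [HeathBrown1994SelmerCongruentII] Heath-Brown 1994, §1 typescript p. 5 L14 (`s(D) ≤ 2ω(D)`),
  p. 6 L26–L28 (the one-prime values); Appendix (Monsky) p. 40 L33–L36, p. 41 L33–L36.
-/

noncomputable section

open Matrix
open Literature.NumberTheory.EllipticCurves.HeathBrown1994
open Literature.NumberTheory.EllipticCurves.HeathBrown1994.Families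

namespace Literature.NumberTheory.EllipticCurves

namespace MonskySelmerParity

/-! ## §1 The bound `s(D) ≤ 2ω(D) − k_D` -/

section Bound

variable {k : ℕ} (p : Fin k → ℕ)

/-- **`s(D) + k_D ≤ 2ω(D)`** for odd `D = p₁⋯p_k`, `k_D = [D ≡ 3 (mod 4)] + [D ≡ ±3 (mod 8)]`:
`s(D) = 2n − k_D − rank M₃` (p. 40 L33–L36). [cite: HeathBrown1994SelmerCongruentII, Appendix (Monsky), typescript p. 40 L33–L36] -/
theorem monskySelmerRankOdd_add_le (hp : ∀ i, (p i).Prime) (hp2 : ∀ i, p i ≠ 2)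
    (hinj : Function.Injective p) :
    monskySelmerRankOdd p + (if (∏ i, p i) % 4 = 1 then 0 else 1) +
        (if (∏ i, p i) % 8 = 1 ∨ (∏ i, p i) % 8 = 7 then 0 else 1) ≤ 2 * k := by
  obtain ⟨r, -, hrank⟩ := rank_monskyMatrixOdd_eq_add p hp hp2 hinj
  have hle : (monskyMatrixOdd p).rank ≤ 2 * k := by
    have := rank_le_card_width (monskyMatrixOdd p)
    rw [Fintype.card_sum, Fintype.card_fin] at this
    omega
  rw [monskySelmerRankOdd]
  omega

/-- `s(D) ≤ 2ω(D) − 2` for odd square-free `D ≡ 3 (mod 8)`. [cite: HeathBrown1994SelmerCongruentII, Appendix (Monsky), typescript p. 40 L33–L36] -/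
theorem monskySelmerRankOdd_le_of_mod_eight_three (hp : ∀ i, (p i).Prime) (hp2 : ∀ i, p i ≠ 2)
    (hinj : Function.Injective p) (h8 : (∏ i, p i) % 8 = 3) :
    monskySelmerRankOdd p + 2 ≤ 2 * k := by
  have h := monskySelmerRankOdd_add_le p hp hp2 hinj
  rw [if_neg (by omega), if_neg (by omega)] at h
  omega

/-- `s(D) ≤ 2ω(D) − 1` for odd square-free `D ≡ 5, 7 (mod 8)`. [cite: HeathBrown1994SelmerCongruentII, Appendix (Monsky), typescript p. 40 L33–L36] -/
theorem monskySelmerRankOdd_le_of_mod_eight_five_or_seven (hp : ∀ i, (p i).Prime)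
    (hp2 : ∀ i, p i ≠ 2) (hinj : Function.Injective p)
    (h8 : (∏ i, p i) % 8 = 5 ∨ (∏ i, p i) % 8 = 7) :
    monskySelmerRankOdd p + 1 ≤ 2 * k := by
  have h := monskySelmerRankOdd_add_le p hp hp2 hinj
  rcases h8 with h8 | h8
  · rw [if_pos (by omega), if_neg (by omega)] at h
    omega
  · rw [if_neg (by omega), if_pos (Or.inr h8)] at h
    omega

/-- **`s(2D₀) + [D₀ ≡ 3 (mod 4)] ≤ 2Ω(D₀)`** for even `D = 2p₁⋯p_k` (p. 41 L33–L36).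
[cite: HeathBrown1994SelmerCongruentII, Appendix (Monsky), typescript p. 41 L33–L36] -/
theorem monskySelmerRankEven_add_le (hp : ∀ i, (p i).Prime) (hp2 : ∀ i, p i ≠ 2)
    (hinj : Function.Injective p) :
    monskySelmerRankEven p + (if (∏ i, p i) % 4 = 1 then 0 else 1) ≤ 2 * k := by
  obtain ⟨r, -, hrank⟩ := rank_monskyMatrixEven_eq_add p hp hp2 hinj
  have hle : (monskyMatrixEven p).rank ≤ 2 * k := by
    have := rank_le_card_width (monskyMatrixEven p)
    rw [Fintype.card_sum, Fintype.card_fin] at this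
    omega
  rw [monskySelmerRankEven]
  omega

/-- `s(2D₀) ≤ 2Ω(D₀) − 1` for `D₀ ≡ 3 (mod 4)` (i.e. `D ≡ 6 (mod 8)`).
[cite: HeathBrown1994SelmerCongruentII, Appendix (Monsky), typescript p. 41 L33–L36] -/
theorem monskySelmerRankEven_le_of_mod_four_three (hp : ∀ i, (p i).Prime) (hp2 : ∀ i, p i ≠ 2)
    (hinj : Function.Injective p) (h4 : (∏ i, p i) % 4 = 3) :
    monskySelmerRankEven p + 1 ≤ 2 * k := by
  have h := monskySelmerRankEven_add_le p hp hp2 hinj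
  rw [if_neg (by omega)] at h
  exact h

end Bound

/-! ## §2 One odd prime: Heath-Brown's table `s(p) = 2, 0, 1, 1` for `p ≡ 1, 3, 5, 7 (mod 8)` -/

section Prime

variable {p : ℕ}

/-- The product over `Fin 1` of `![p]` is `p`. [cite: HeathBrown1994SelmerCongruentII, §1 typescript p. 6 L26–L28] -/
theorem prod_vecSingle : (∏ i, (![p] : Fin 1 → ℕ) i) = p := by
  simp

/-- Monsky's odd matrix of a prime `p ≡ 1 (mod 8)` vanishes: `A = (0)`, `D₂ = D₋₂ = (0)`.
[cite: HeathBrown1994SelmerCongruentII, §1 typescript p. 6 L26–L28; Appendix (Monsky) p. 39 L27–L32 (evaluation ours)] -/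
theorem monskyMatrixOdd_one_mod_eight (h8 : p % 8 = 1) : monskyMatrixOdd ![p] = 0 := by
  have h2 : addLegendreSym 2 p = 0 := addLegendreSym_of_eq_one (jacobiSym_two_eq_one (Or.inl h8))
  have hm2 : addLegendreSym (-2) p = 0 :=
    addLegendreSym_of_eq_one (jacobiSym_neg_two_eq_one (Or.inl h8))
  ext i j
  rcases i with i | i <;> rcases j with j | j <;>
    · obtain rfl : i = 0 := Subsingleton.elim _ _
      obtain rfl : j = 0 := Subsingleton.elim _ _
      simp [monskyMatrixOdd, legendreMatrix, legendreDiagonal, Matrix.fromBlocks, h2, hm2]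

/-- **Heath-Brown's one-prime table**: for an odd prime `p`, `s(p) = 2` if `p ≡ 1 (mod 8)`, `0` if
`p ≡ 3 (mod 8)`, `1` if `p ≡ 5, 7 (mod 8)` — from the bound `s ≤ 2 − k_p`, the parity, and `M = 0`
for `p ≡ 1 (mod 8)`. [cite: HeathBrown1994SelmerCongruentII, §1 typescript p. 6 L26–L28] -/
theorem monskySelmerRankOdd_prime (hp : p.Prime) (hp2 : p ≠ 2) :
    monskySelmerRankOdd ![p] = if p % 8 = 1 then 2 else if p % 8 = 3 then 0 else 1 := by
  have hodd : p % 2 = 1 := Nat.odd_iff.mp (hp.odd_of_ne_two hp2)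
  have hp' : ∀ i, ((![p] : Fin 1 → ℕ) i).Prime := fun i => by fin_cases i; exact hp
  have hp2' : ∀ i, (![p] : Fin 1 → ℕ) i ≠ 2 := fun i => by fin_cases i; exact hp2
  have hinj : Function.Injective (![p] : Fin 1 → ℕ) := Function.injective_of_subsingleton _
  by_cases h1 : p % 8 = 1
  · rw [if_pos h1, monskySelmerRankOdd, monskyMatrixOdd_one_mod_eight h1, rank_zero]
  rw [if_neg h1]
  have hbound := monskySelmerRankOdd_add_le ![p] hp' hp2' hinj
  have hpar := even_monskySelmerRankOdd_iff ![p] hp' hp2' hinj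
  rw [prod_vecSingle] at hbound hpar
  by_cases h3 : p % 8 = 3
  · rw [if_pos h3]
    rw [if_neg (by omega), if_neg (by omega)] at hbound
    omega
  · rw [if_neg h3]
    have h57 : p % 8 = 5 ∨ p % 8 = 7 := by omega
    have hodd1 : ¬ Even (monskySelmerRankOdd ![p]) := fun he => by have := hpar.mp he; omega
    rcases h57 with h5 | h7
    · rw [if_pos (by omega), if_neg (by omega)] at hbound
      rcases Nat.even_or_odd (monskySelmerRankOdd ![p]) with he | ⟨m, hm⟩
      · exact absurd he hodd1
      · omega
    · rw [if_neg (by omega), if_pos (Or.inr h7)] at hbound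
      rcases Nat.even_or_odd (monskySelmerRankOdd ![p]) with he | ⟨m, hm⟩
      · exact absurd he hodd1
      · omega

/-- **`#Sel⁽²⁾(E_p/ℚ)` for an odd prime `p`**: `16, 4, 8, 8` for `p ≡ 1, 3, 5, 7 (mod 8)` (the table
and the `2`-Selmer formula `monsky_card_selmerGroup_two_odd_holds`).
[cite: HeathBrown1994SelmerCongruentII, §1 typescript p. 1 L14–L20 and p. 6 L26–L28] -/
theorem card_selmerGroup_two_congruentNumberCurve_prime (hp : p.Prime) (hp2 : p ≠ 2) :
    Nat.card ((congruentNumberCurve p).selmerGroup 2) =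
      if p % 8 = 1 then 16 else if p % 8 = 3 then 4 else 8 := by
  have hp' : ∀ i, ((![p] : Fin 1 → ℕ) i).Prime := fun i => by fin_cases i; exact hp
  have hodd' : ∀ i, Odd ((![p] : Fin 1 → ℕ) i) := fun i => by fin_cases i; exact hp.odd_of_ne_two hp2
  have hinj : Function.Injective (![p] : Fin 1 → ℕ) := Function.injective_of_subsingleton _
  have key : ∀ {N : ℕ}, (∏ i, (![p] : Fin 1 → ℕ) i) = N →
      Nat.card ((congruentNumberCurve N).selmerGroup 2) = 2 ^ (2 + monskySelmerRankOdd ![p]) := by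
    intro N hN
    subst hN
    exact monsky_card_selmerGroup_two_odd_holds 1 ![p] hp' hodd' hinj
  have h := key prod_vecSingle
  rw [monskySelmerRankOdd_prime hp hp2] at h
  rw [h]
  by_cases h1 : p % 8 = 1
  · simp [h1]
  · by_cases h3 : p % 8 = 3
    · simp [h3]
    · rw [if_neg h1, if_neg h3, if_neg h1, if_neg h3]
      norm_num

end Prime

/-! ## §3 `D = 2p`: the table `s(2p) = 2, 1, 0, 1` for `p ≡ 1, 3, 5, 7 (mod 8)` -/

section TwoMulPrime

variable {p : ℕ}

/-- Monsky's even matrix of `D = 2p`, `p ≡ 1 (mod 8)`, vanishes: `A = (0)`, `D₂ = D₋₁ = (0)`.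
[cite: HeathBrown1994SelmerCongruentII, Appendix (Monsky), typescript p. 41 L20–L36 (evaluation ours)] -/
theorem monskyMatrixEven_one_mod_eight (h8 : p % 8 = 1) : monskyMatrixEven ![p] = 0 := by
  have h2 : addLegendreSym 2 p = 0 := addLegendreSym_of_eq_one (jacobiSym_two_eq_one (Or.inl h8))
  have hm1 : addLegendreSym (-1) p = 0 :=
    addLegendreSym_of_eq_one (jacobiSym_neg_one_eq_one (by omega))
  ext i j
  rcases i with i | i <;> rcases j with j | j <;>
    · obtain rfl : i = 0 := Subsingleton.elim _ _
      obtain rfl : j = 0 := Subsingleton.elim _ _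
      simp [monskyMatrixEven, legendreMatrix, legendreDiagonal, Matrix.fromBlocks, h2, hm1]

/-- **The table for `D = 2p`**, `p` an odd prime: `s(2p) = 2` if `p ≡ 1 (mod 8)`, `1` if
`p ≡ 3, 7 (mod 8)`, `0` if `p ≡ 5 (mod 8)` — from `M = 0` (`p ≡ 1`), `det M = 1` (`p ≡ 5`, tree:
`det_monskyMatrixEven_five_mod_eight`), and the bound `s ≤ 1` with odd parity (`p ≡ 3 (mod 4)`).
[cite: HeathBrown1994SelmerCongruentII, Appendix (Monsky), typescript p. 41 L20–L36 (evaluation ours); §1 p. 5 L40–L44 (the frequencies for `s(2D)`)] -/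
theorem monskySelmerRankEven_prime (hp : p.Prime) (hp2 : p ≠ 2) :
    monskySelmerRankEven ![p] = if p % 8 = 1 then 2 else if p % 8 = 5 then 0 else 1 := by
  have hodd : p % 2 = 1 := Nat.odd_iff.mp (hp.odd_of_ne_two hp2)
  have hp' : ∀ i, ((![p] : Fin 1 → ℕ) i).Prime := fun i => by fin_cases i; exact hp
  have hp2' : ∀ i, (![p] : Fin 1 → ℕ) i ≠ 2 := fun i => by fin_cases i; exact hp2
  have hinj : Function.Injective (![p] : Fin 1 → ℕ) := Function.injective_of_subsingleton _
  by_cases h1 : p % 8 = 1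
  · rw [if_pos h1, monskySelmerRankEven, monskyMatrixEven_one_mod_eight h1, rank_zero]
  rw [if_neg h1]
  by_cases h5 : p % 8 = 5
  · rw [if_pos h5]
    exact monskySelmerRankEven_eq_zero_of_det _ (det_monskyMatrixEven_five_mod_eight h5)
  rw [if_neg h5]
  have h37 : p % 4 = 3 := by omega
  have hbound := monskySelmerRankEven_le_of_mod_four_three ![p] hp' hp2' hinj
    (by rw [prod_vecSingle]; exact h37)
  have hpar := even_monskySelmerRankEven_iff ![p] hp' hp2' hinj
  rw [prod_vecSingle] at hpar
  have hodd1 : ¬ Even (monskySelmerRankEven ![p]) := fun he => by have := hpar.mp he; omega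
  rcases Nat.even_or_odd (monskySelmerRankEven ![p]) with he | ⟨m, hm⟩
  · exact absurd he hodd1
  · omega

/-- **`#Sel⁽²⁾(E_{2p}/ℚ)` for an odd prime `p`**: `16, 8, 4, 8` for `p ≡ 1, 3, 5, 7 (mod 8)` (the
table and `monsky_card_selmerGroup_two_even_holds`).
[cite: HeathBrown1994SelmerCongruentII, §1 typescript p. 1 L14–L20; Appendix (Monsky) p. 41 L20–L36 (evaluation ours)] -/
theorem card_selmerGroup_two_congruentNumberCurve_two_mul_prime (hp : p.Prime) (hp2 : p ≠ 2) :
    Nat.card ((congruentNumberCurve (2 * p)).selmerGroup 2) =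
      if p % 8 = 1 then 16 else if p % 8 = 5 then 4 else 8 := by
  have hp' : ∀ i, ((![p] : Fin 1 → ℕ) i).Prime := fun i => by fin_cases i; exact hp
  have hodd' : ∀ i, Odd ((![p] : Fin 1 → ℕ) i) := fun i => by fin_cases i; exact hp.odd_of_ne_two hp2
  have hinj : Function.Injective (![p] : Fin 1 → ℕ) := Function.injective_of_subsingleton _
  have key : ∀ {N : ℕ}, (∏ i, (![p] : Fin 1 → ℕ) i) = N →
      Nat.card ((congruentNumberCurve (2 * N)).selmerGroup 2) = 2 ^ (2 + monskySelmerRankEven ![p]) := by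
    intro N hN
    subst hN
    exact monsky_card_selmerGroup_two_even_holds 1 ![p] hp' hodd' hinj
  have h := key prod_vecSingle
  rw [monskySelmerRankEven_prime hp hp2] at h
  rw [h]
  by_cases h1 : p % 8 = 1
  · simp [h1]
  · by_cases h5 : p % 8 = 5
    · simp [h5]
    · rw [if_neg h1, if_neg h5, if_neg h1, if_neg h5]
      norm_num

end TwoMulPrime

end MonskySelmerParity

end Literature.NumberTheory.EllipticCurves

end
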